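import Summits.ResolutionOfSingularities.ResolutionOfSingularities.Theorems.PurelyInseparableDim4ResConeCInfGameStep
import Summits.ResolutionOfSingularities.ResolutionOfSingularities.Theorems.PurelyInseparableDim4ResConeCornerWalls
import Summits.ResolutionOfSingularities.ResolutionOfSingularities.Theorems.PurelyInseparableDim4ResConeCInfNormalForm
import HarnessLib
import HarnessLib.Audit.Tags

/-!
# Purely inseparable four-folds — THE `u`-AXIS FLAG VALUE `V(0) ≠ 0` AT A CHILD OF A CORNER STEP
# (cell `res-dim4-pi`, K2(p) lane, slice B; K24c L2b item (D3), by signature for res-dim4-p-3 g4)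

[OURS · counted 0 · cell `res-dim4-pi` · K2(p) lane (holder res-dim4-p-12 g3); K24c L2b's carry list item (R4)/(D3)
(res-dim4-p-3 g4, bus 2026-08-29 03:37:43Z: «hV … at the re-framed state, derivable: at any CHILD of a slot step,
u-axis isolation + exact ledger force the witness x_λx_μu^e to e = 3 by F2a's backward law — small, open for a
second»); idea res-dim4-idea-4 g3 HANDOFF-g3 §11 («after the first step s₀₀₃ ≠ 0 for ever»); seat res-dim4-typ-1 g3.]
Nothing here proves K2(p)/K2(5), `NoIsolatedTrap 5 5` or resolution of singularities in dimension ≥ 4 /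
characteristic `p` — NOT proved.  AI kernel work, weaker than expert review.

ONE pure corner step `s′ = CentreBlowup.step 5 univ j 0 s` in a boundary chart `j`, fixed letters `j, i` (ledger),
`u, f` (free).  INPUT: at the parent, `x_j ∣ F` and the `j`-half of the pair ledger «monomials of `x_f`-degree
`≤ 3` have `x_j`-exponent `≥ 2`» (res-dim4-p-3 g4's EXACT ledger (B), or any frame with it); at the child,
ISOLATION, `x_j x_i ∣ F′`, the full pair ledger, order `≥ 6` and the STRAIGHT degree-`6` layer (`x_f`-exponent `4`).
OUTPUT **`cInf_uFlag_of_child`**: `coeff_{x_j² x_i² u³} F′ ≠ 0` — the `u`-axis flag VALUE `V(0)` of the C∞ normal form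
(`S₀ = B₀ + ūB₁ + ū³V`).  Proof: isolation forbids the `u`-axis `V(x_j, x_i, x_f)` to be `5`-fold (p-5's
`ordAlong_erase_lt_of_isIsolated`), giving a monomial with `j + i + f`-degree `≤ 4`; the ledger pins it to
`x_j² x_i² u^e`, order and straightness give `e ≥ 3`, and res-dim4-p-2 g4's BACKWARD LAW
`exists_parent_of_coeff_step_zero_gameExp_of_ledger` (game monomial `(c,a,b,e) = (3,0,0,e)`, parent `(3, 3−e, 0, e)`)
gives `e ≤ 3`.  `cInf_uFlag_of_child'` pulls the value back to the parent by res-dim4-typ-1 g2's fixed-point law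
`cInf_coeff_uFlag_step_zero` (F1 (P)).
bears_on: LADDER-RESOLUTION:D157-DOOR2 (res-dim4-pi · K2(p) · slice B · K24c L2b (D3)).  Supports
stmt-ResolutionOfSingularities-16155 (helper).
-/

set_option linter.dupNamespace false -- mandated namespace of this single-conjunct summit

noncomputable section

namespace Summit.ResolutionOfSingularities.ResolutionOfSingularities.Theorems.PIDim4

namespace ResCone

open MvPolynomial Finset
open Literature.AlgebraicGeometry.Resolution
open Literature.AlgebraicGeometry.Resolution.CentreBlowup
open Literature.AlgebraicGeometry.Resolution.Hauser2010
open Literature.AlgebraicGeometry.Resolution.HauserPerlega2019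

variable {K : Type} [Field K] [DecidableEq K]

/-- **THE `u`-AXIS FLAG VALUE AT A CHILD** (K24c L2b (D3)).  After a pure corner step in the boundary chart `j`:
if the parent has `x_j ∣ F` and the `j`-half of the pair ledger, and the child is ISOLATED with `x_j x_i ∣ F′`, the
pair ledger, order `≥ 6` and a straight degree-`6` layer, then `coeff_{x_j² x_i² u³} F′ ≠ 0`. [OURS]
[cite: HauserPerlega2019PRIMS, §2 (permissible blowups)] [cite: CossartJannsenSaito2020, Lemma 13.2] -/
theorem cInf_uFlag_of_child {j i u f : Fin 4} (hji : j ≠ i) (hju : j ≠ u) (hjf : j ≠ f) (hiu : i ≠ u)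
    (hif : i ≠ f) (huf : u ≠ f) {s : State K} (hr1 : ∀ d ∈ s.F.support, 1 ≤ d j)
    (hledP : ∀ d ∈ s.F.support, d f ≤ 3 → 2 ≤ d j)
    (hiso' : IsIsolated 5 (CentreBlowup.step 5 Finset.univ j 0 s).F)
    (hr' : ∀ d ∈ (CentreBlowup.step 5 Finset.univ j 0 s).F.support, 1 ≤ d j ∧ 1 ≤ d i)
    (hled' : ∀ d ∈ (CentreBlowup.step 5 Finset.univ j 0 s).F.support, d f ≤ 3 → 2 ≤ d j ∧ 2 ≤ d i)
    (h6' : ∀ d ∈ (CentreBlowup.step 5 Finset.univ j 0 s).F.support, 6 ≤ d.degree)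
    (hstraight' : ∀ d ∈ (CentreBlowup.step 5 Finset.univ j 0 s).F.support, d.degree = 6 → d f = 4) :
    coeff (Finsupp.single j 2 + Finsupp.single i 2 + Finsupp.single u 3)
      (CentreBlowup.step 5 Finset.univ j 0 s).F ≠ 0 := by
  set s' := CentreBlowup.step 5 Finset.univ j 0 s with hs'
  -- the `u`-axis is not `5`-fold at the isolated child
  obtain ⟨d, hd, hdeg⟩ := exists_degIn_lt_of_ordAlong_lt (ordAlong_erase_lt_of_isIsolated hiso' u)
  have hsum := degIn_erase_add_apply u d
  have hquad := degree_eq_quad hji hju hjf hiu hif huf d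
  obtain ⟨hj1, hi1⟩ := hr' d hd
  -- the ledger pins the witness to `x_j² x_i² u^e`
  obtain ⟨hj2, hi2⟩ := hled' d hd (by omega)
  have hdj : d j = 2 := by omega
  have hdi : d i = 2 := by omega
  have hdf : d f = 0 := by omega
  -- order and straightness: `e ≥ 3`
  have he3 : 3 ≤ d u := by
    have h6 := h6' d hd
    by_contra hlt
    have hdeg6 : d.degree = 6 := by omega
    have := hstraight' d hd hdeg6
    omega
  -- the backward law: `e ≤ 3`
  have hdE : d = Finsupp.single j 2 + Finsupp.single i 2 + Finsupp.single u (d u) + Finsupp.single f 0 := by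
    conv_lhs => rw [eq_sum_single_four hji hju hjf hiu hif huf d, hdj, hdi, hdf]
  have hcoeff : coeff (Finsupp.single j (0 + 2) + Finsupp.single i (0 + 2) + Finsupp.single u (d u) +
      Finsupp.single f (3 - 3)) s'.F ≠ 0 := by
    rw [show (0 : ℕ) + 2 = 2 from rfl, show (3 : ℕ) - 3 = 0 from rfl, ← hdE]; exact mem_support_iff.mp hd
  obtain ⟨a₀, -, ha₀⟩ := exists_parent_of_coeff_step_zero_gameExp_of_ledger hji hju hjf hiu hif huf s hr1
    (N := 8) (fun d hd hdf _ => hledP d hd hdf) (c := 3) le_rfl (by norm_num) hcoeff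
  have hdu : d u = 3 := by omega
  rw [show Finsupp.single j 2 + Finsupp.single i 2 + Finsupp.single u 3 = d by
    rw [hdE, hdu, Finsupp.single_zero, add_zero]]
  exact mem_support_iff.mp hd

/-- **The same, in the F1 (P) dress and pulled back to the parent**: with `r = x_j x_i` and `ord₀ F = 6` at the parent,
the flag monomial `x^r · x_j x_i u³` is a fixed point of the chart law (res-dim4-typ-1 g2's
`cInf_coeff_uFlag_step_zero`), so `V(0) ≠ 0` holds at the parent AND at the child. [OURS]
[cite: HauserPerlega2019PRIMS, §2 (permissible blowups)] -/
theorem cInf_uFlag_of_child' {j i u f : Fin 4} (hji : j ≠ i) (hju : j ≠ u) (hjf : j ≠ f) (hiu : i ≠ u)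
    (hif : i ≠ f) (huf : u ≠ f) {s : State K} (hr : s.r = Finsupp.single j 1 + Finsupp.single i 1)
    (ho : ordZero s.F = 6) (hr1 : ∀ d ∈ s.F.support, 1 ≤ d j)
    (hledP : ∀ d ∈ s.F.support, d f ≤ 3 → 2 ≤ d j)
    (hiso' : IsIsolated 5 (CentreBlowup.step 5 Finset.univ j 0 s).F)
    (hr' : ∀ d ∈ (CentreBlowup.step 5 Finset.univ j 0 s).F.support, 1 ≤ d j ∧ 1 ≤ d i)
    (hled' : ∀ d ∈ (CentreBlowup.step 5 Finset.univ j 0 s).F.support, d f ≤ 3 → 2 ≤ d j ∧ 2 ≤ d i)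
    (h6' : ∀ d ∈ (CentreBlowup.step 5 Finset.univ j 0 s).F.support, 6 ≤ d.degree)
    (hstraight' : ∀ d ∈ (CentreBlowup.step 5 Finset.univ j 0 s).F.support, d.degree = 6 → d f = 4) :
    coeff (s.r + (Finsupp.single j 1 + Finsupp.single i 1 + Finsupp.single u 3)) s.F ≠ 0 ∧
      coeff (s.r + (Finsupp.single j 1 + Finsupp.single i 1 + Finsupp.single u 3))
        (CentreBlowup.step 5 Finset.univ j 0 s).F ≠ 0 := by
  have hexp : s.r + (Finsupp.single j 1 + Finsupp.single i 1 + Finsupp.single u 3) =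
      Finsupp.single j 2 + Finsupp.single i 2 + Finsupp.single u 3 := by
    rw [hr]
    ext k
    simp only [Finsupp.add_apply, Finsupp.single_apply]
    split_ifs <;> omega
  have hchild := cInf_uFlag_of_child hji hju hjf hiu hif huf hr1 hledP hiso' hr' hled' h6' hstraight'
  rw [← hexp] at hchild
  refine ⟨?_, hchild⟩
  rw [← cInf_coeff_uFlag_step_zero hji hju.symm hiu.symm (Or.inl rfl) hr ho]
  exact hchild

end ResCone

end Summit.ResolutionOfSingularities.ResolutionOfSingularities.Theorems.PIDim4

end
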